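import Summits.CriticalPhenomena.PercolationContinuityZ3.Theorems.PercNearOneGluingNoHeavyQuantGluedFourTrueFloorLiftFree
import Summits.CriticalPhenomena.PercolationContinuityZ3.Theorems.PercNearOneGluingNoHeavyQuantFourBlobAverageFloor
import HarnessLib

/-!
# QUANT lane R8, T-DEC: THE IDENTICAL GLUED QUADRUPLE `(R^r[q](R^k[g]))⁴` IS SDEC AT ITS TRUE FLOOR `q·g` — EVERY SHAPE `(r, k)`, ALL
# `0 < q < 1`, `0 < g < 1` (prim-quant-census-2 gen 80)

builds on p205010 (kernel theorem, internal audit signed; external expert review pending)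

Support file (`--supports stmt-CriticalPhenomena-4575`), QUANT lane census seat prim-quant-census-2 (gen 80); memo
`run/shared/lean/prim/quant/prim-quant-census-2-g80/TRIPLE-G80.md` §5.  Theorems only, standard axioms, no sorries, no definitions.

**`sdec_gluedFour_trueFloor`**: `ρ = blobLaw [(k,g),(r,1)]` (the root-scaled glued sibling `R^r[q](R^k[g])` before its gate), `t = gate_q ρ`:
`SDEC (q·g) (4(r+k)) (((t ∗ t) ∗ t) ∗ t)` for EVERY shape `(r, k)` and EVERY `0 < q < 1` — the width-4 row of the identical-forest table at the
TRUE floor `q·g` (`…QuantGluedFourTrueFloorLiftFree` had it for `q ≤ 3/4`).  PROOF = the outer-gate mixture of width 4: for an outer gate `a`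
(`m = aq`) the law `gate_a(t⁴)` is the convex combination `gate_gluedFour_eq_mix_low/mid/high` of laws each `DECAtT (m·g) (4m(r+kg)) j`:
the gated blob laws `gate_m(ρ⁴)`, `gate_{4m/3}(ρ³)`, `gate_{2m}(ρ²)`, the quadruple's own binomial `t_m⁴` and the pair of gated pairs
`gate_m(ρ²) ∗ gate_m(ρ²)` (`…QuantGluedFourComponents`, lift-free, via `ConvClosedT` and the WIDTH-3 THEOREM), and — in the polarized corner
`m > 3/4` only — the lift `ρ³ ∗ gate_{4m−3} ρ` (**`decAtT_comp4_lift`**), which is DEC at floor `m·g` by the FOUR-BLOB AVERAGE-GATE LEMMA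
(`…QuantFourBlobAverageFloor`: four equal blobs with gates `g, g, g, (4m−3)g` are heavy-DEC at their average gate `m·g`, plus the partial / full
root shifts of `…QuantHeavyShift`).  The corner weight `α = 1 − β − w_Q − w_X = q²(1−a)(3−2q)/(1−m) ≥ 0` (an identity, `ring`).
No shape parameter enters: long tails `k ≫ r` included, where every `ConvClosedT` budget split of the lift fails (memo §1).

HONEST STATUS.  Identical glued forests of widths 2, 3, 4 at the true floor: kernel, every shape; width `n ≥ 5` needs the `n`-blob average-gate
lemma (conjecture BLOB-AFL of the memo, numerically 0 failures for `n ≤ 8`) or another device; `SiblingStep`, `FarTreeRow` OPEN; RATE class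
(log\*) / honest sentence of `run/shared/lean/prim/quant/README.md` unchanged.  [this work].  Nothing here is cited as a published result.  The
gluing rows served [cite: KozmaNitzan2024, Conjecture 3 (p. 15)]; product measure [cite: Grimmett1999, §1.3 p. 10].
-/

noncomputable section

open scoped BigOperators

namespace Summit.CriticalPhenomena.PercolationContinuityZ3.Theorems
namespace Quant
namespace LawDec

open Finset

/-! ### The polarized component of width 4 -/

/-- **the lift component**: for `3/4 < m ≤ 1`, `ρ ∗ ρ ∗ ρ ∗ gate_{4m−3} ρ` is `DECAtT (m·g) (4m(r+kg)) j (4(r+k))` at every layer `j` — the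
four-blob average-gate lift `decAtT_threeSureOneGated` read at `c = 4m − 3` (`(3+c)/4 = m`). [this work] -/
theorem decAtT_comp4_lift (r k : ℕ) {g m : ℝ} (hg0 : 0 < g) (hg1 : g < 1) (hm : 3 / 4 < m) (hm1 : m ≤ 1) (j : ℕ) :
    DECAtT (m * g) (4 * (m * ((r : ℝ) + k * g))) j ((r + k) + (r + k) + (r + k) + (r + k))
      (lconv ((r + k) + (r + k) + (r + k)) (r + k)
        (lconv ((r + k) + (r + k)) (r + k) (lconv (r + k) (r + k) (blobLaw [(k, g), (r, 1)]) (blobLaw [(k, g), (r, 1)]))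
          (blobLaw [(k, g), (r, 1)]))
        (gate (blobLaw [(k, g), (r, 1)]) (4 * m - 3))) := by
  have d := decAtT_threeSureOneGated r k hg0 hg1 (by linarith : 0 < 4 * m - 3) (by linarith : 4 * m - 3 ≤ 1) j
  have e1 : (3 + (4 * m - 3)) * g / 4 = m * g := by ring
  have e2 : (3 + (4 * m - 3)) * ((r : ℝ) + k * g) = 4 * (m * ((r : ℝ) + k * g)) := by ring
  rwa [e1, e2] at d

/-! ### The identical glued quadruple at its true floor -/

/-- **THE IDENTICAL GLUED QUADRUPLE AT ITS TRUE FLOOR — EVERY SHAPE, EVERY GATE.**  `ρ = blobLaw [(k,g),(r,1)]`, `t = gate_q ρ`, `0 < q < 1`,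
`0 < g < 1`: `SDEC (q·g) (4(r+k)) (((t ∗ t) ∗ t) ∗ t)`.  Three menus by the outer floor gate `m = aq`: `m ≤ 1/2` and `1/2 < m ≤ 3/4` lift-free
(as in `sdec_gluedFour_trueFloor_of_le`), `m > 3/4` with the four-blob lift `decAtT_comp4_lift`. [this work] -/
theorem sdec_gluedFour_trueFloor (r k : ℕ) {q g : ℝ} (hq0 : 0 < q) (hq1 : q < 1) (hg0 : 0 < g) (hg1 : g < 1) :
    SDEC (q * g) ((r + k) + (r + k) + (r + k) + (r + k))
      (lconv ((r + k) + (r + k) + (r + k)) (r + k)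
        (lconv ((r + k) + (r + k)) (r + k)
          (lconv (r + k) (r + k) (gate (blobLaw [(k, g), (r, 1)]) q) (gate (blobLaw [(k, g), (r, 1)]) q))
          (gate (blobLaw [(k, g), (r, 1)]) q))
        (gate (blobLaw [(k, g), (r, 1)]) q)) := by
  intro a ha0 ha1 j hj
  set ρ : ℕ → ℝ := blobLaw [(k, g), (r, 1)] with hρ
  have hm0 : 0 < a * q := mul_pos ha0 hq0
  have hmq : a * q ≤ q := by nlinarith
  have hm1 : a * q < 1 := lt_of_le_of_lt hmq hq1
  have hmne : 1 - a * q ≠ 0 := by linarith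
  have hmne' : 1 - q * a ≠ 0 := by rwa [mul_comm] at hmne
  have hβ0 : 0 ≤ (1 - q) ^ 3 / (1 - a * q) ^ 3 := div_nonneg (pow_nonneg (by linarith) 3) (pow_nonneg (by linarith) 3)
  have hqm : 0 ≤ q + a * q - 2 * (a * q) * q := by nlinarith [mul_nonneg hm0.le (by linarith : 0 ≤ 1 - q)]
  have hw3 : 0 ≤ 3 * q * (1 - q) * (1 - a) * (q + a * q - 2 * (a * q) * q) / (1 - a * q) ^ 2 :=
    div_nonneg (mul_nonneg (mul_nonneg (mul_nonneg (by positivity) (by linarith)) (by linarith)) hqm) (sq_nonneg _)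
  -- laws and the mean of the gated quadruple
  obtain ⟨a0, aM, a1, amn⟩ := glued_blob_laws r k hg0.le hg1.le
  obtain ⟨u0, uM, u1⟩ := gate_laws (r + k) ρ q hq0.le hq1.le a0 aM a1
  have umn : ∑ h ∈ Finset.range (r + k + 1), (h : ℝ) * gate ρ q h = q * ((r : ℝ) + k * g) := by rw [sum_mul_gate, amn]
  obtain ⟨p0, pM, p1, pmn⟩ := lconv_laws u0 u1 umn u0 u1 umn
  obtain ⟨t0, tM, t1, tmn⟩ := lconv_laws p0 p1 pmn u0 u1 umn
  obtain ⟨f0, fM, f1, fmn⟩ := lconv_laws t0 t1 tmn u0 u1 umn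
  rw [decAt_iff_decAtT, sum_mul_gate, fmn]
  have eT : a * (q * ((r : ℝ) + k * g) + q * ((r : ℝ) + k * g) + q * ((r : ℝ) + k * g) + q * ((r : ℝ) + k * g))
      = 4 * ((a * q) * ((r : ℝ) + k * g)) := by ring
  have ex : a * (q * g) = (a * q) * g := by ring
  rw [eT, ex]
  -- common components
  have hC := decAtT_comp4_blob4 r k hg0 hg1 hm0 hm1.le j hj
  have hB := decAtT_comp4_binomial r k hg0 hg1 hm0 hm1 j hj
  by_cases h34 : a * q ≤ 3 / 4
  · have hG3 := decAtT_comp4_blob3g r k hg0 hg1 hm0 (e := 4 * (a * q) / 3) (by ring) (by linarith) j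
    by_cases hcase : a * q ≤ 1 / 2
    · -- {gate_m ρ⁴, t_m⁴, gate_{4m/3} ρ³, gate_{2m} ρ²}
      have hG2 := decAtT_comp4_blob2g r k hg0 hg1 hm0 (e := 2 * (a * q)) rfl (by linarith) j
      have hα0 : 0 ≤ q ^ 3 - (a * q) ^ 3 * ((1 - q) ^ 3 / (1 - a * q) ^ 3) := by
        have h1 : a * q * (1 - q) ≤ q * (1 - a * q) := by nlinarith
        have h2 : (a * q * (1 - q)) ^ 3 ≤ (q * (1 - a * q)) ^ 3 :=
          pow_le_pow_left₀ (mul_nonneg hm0.le (by linarith)) h1 3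
        have hpos : 0 < (1 - a * q) ^ 3 := pow_pos (by linarith) 3
        rw [sub_nonneg, ← mul_div_assoc, div_le_iff₀ hpos]
        nlinarith
      have hw2 : 0 ≤ 3 * q * (1 - q) ^ 2 * (1 - a) / (1 - a * q) :=
        div_nonneg (mul_nonneg (mul_nonneg (by positivity) (sq_nonneg _)) (by linarith)) (by linarith)
      refine decAtT_finite_mixture (ι := Fin 4) _ _ j _ _
        ![q ^ 3 - (a * q) ^ 3 * ((1 - q) ^ 3 / (1 - a * q) ^ 3), (1 - q) ^ 3 / (1 - a * q) ^ 3,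
          3 * q * (1 - q) * (1 - a) * (q + a * q - 2 * (a * q) * q) / (1 - a * q) ^ 2, 3 * q * (1 - q) ^ 2 * (1 - a) / (1 - a * q)]
        ![gate (lconv ((r + k) + (r + k) + (r + k)) (r + k) (lconv ((r + k) + (r + k)) (r + k) (lconv (r + k) (r + k) ρ ρ) ρ) ρ) (a * q),
          lconv ((r + k) + (r + k) + (r + k)) (r + k)
            (lconv ((r + k) + (r + k)) (r + k) (lconv (r + k) (r + k) (gate ρ (a * q)) (gate ρ (a * q))) (gate ρ (a * q))) (gate ρ (a * q)),
          gate (lconv ((r + k) + (r + k)) (r + k) (lconv (r + k) (r + k) ρ ρ) ρ) (4 * (a * q) / 3),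
          gate (lconv (r + k) (r + k) ρ ρ) (2 * (a * q))]
        ?_ ?_ (fun h => ?_) ?_
      · intro i; fin_cases i
        · exact hα0
        · exact hβ0
        · exact hw3
        · exact hw2
      · rw [Fin.sum_univ_four]
        show q ^ 3 - (a * q) ^ 3 * ((1 - q) ^ 3 / (1 - a * q) ^ 3) + (1 - q) ^ 3 / (1 - a * q) ^ 3
          + 3 * q * (1 - q) * (1 - a) * (q + a * q - 2 * (a * q) * q) / (1 - a * q) ^ 2 + 3 * q * (1 - q) ^ 2 * (1 - a) / (1 - a * q) = 1
        field_simp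
        ring
      · rw [Fin.sum_univ_four]
        exact gate_gluedFour_eq_mix_low (r + k) ρ aM a q hmne h
      · intro i hi
        fin_cases i
        · exact hC
        · exact hB
        · exact hG3
        · exact hG2
    · -- {gate_m ρ⁴, t_m⁴, gate_m ρ² ∗ gate_m ρ², gate_{4m/3} ρ³}
      have hQ := decAtT_comp4_pairpair r k hg0 hg1 hm0 hm1.le j hj
      have hwQ : 0 ≤ 3 * q * (1 - q) ^ 2 * (1 - a) / (1 - a * q) ^ 2 :=
        div_nonneg (mul_nonneg (mul_nonneg (by positivity) (sq_nonneg _)) (by linarith)) (sq_nonneg _)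
      have hα0 : 0 ≤ q ^ 3 - (a * q) ^ 3 * ((1 - q) ^ 3 / (1 - a * q) ^ 3) - (a * q) * (3 * q * (1 - q) ^ 2 * (1 - a) / (1 - a * q) ^ 2) := by
        have hpos : 0 < (1 - a * q) ^ 3 := pow_pos (by linarith) 3
        have key : (a * q) ^ 3 * (1 - q) ^ 3 + (a * q) * (3 * q * (1 - q) ^ 2 * (1 - a)) * (1 - a * q) ≤ q ^ 3 * (1 - a * q) ^ 3 :=
          gluedFour_alpha_mid_key a q ha0 ha1 hq0 hq1 (lt_of_not_ge hcase)
        have e : q ^ 3 - (a * q) ^ 3 * ((1 - q) ^ 3 / (1 - a * q) ^ 3) - (a * q) * (3 * q * (1 - q) ^ 2 * (1 - a) / (1 - a * q) ^ 2)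
            = (q ^ 3 * (1 - a * q) ^ 3 - ((a * q) ^ 3 * (1 - q) ^ 3 + (a * q) * (3 * q * (1 - q) ^ 2 * (1 - a)) * (1 - a * q)))
              / (1 - a * q) ^ 3 := by
          field_simp
          ring
        rw [e]
        exact div_nonneg (by linarith) hpos.le
      refine decAtT_finite_mixture (ι := Fin 4) _ _ j _ _
        ![q ^ 3 - (a * q) ^ 3 * ((1 - q) ^ 3 / (1 - a * q) ^ 3) - (a * q) * (3 * q * (1 - q) ^ 2 * (1 - a) / (1 - a * q) ^ 2),
          (1 - q) ^ 3 / (1 - a * q) ^ 3, 3 * q * (1 - q) ^ 2 * (1 - a) / (1 - a * q) ^ 2,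
          3 * q * (1 - q) * (1 - a) * (q + a * q - 2 * (a * q) * q) / (1 - a * q) ^ 2]
        ![gate (lconv ((r + k) + (r + k) + (r + k)) (r + k) (lconv ((r + k) + (r + k)) (r + k) (lconv (r + k) (r + k) ρ ρ) ρ) ρ) (a * q),
          lconv ((r + k) + (r + k) + (r + k)) (r + k)
            (lconv ((r + k) + (r + k)) (r + k) (lconv (r + k) (r + k) (gate ρ (a * q)) (gate ρ (a * q))) (gate ρ (a * q))) (gate ρ (a * q)),
          lconv ((r + k) + (r + k)) ((r + k) + (r + k)) (gate (lconv (r + k) (r + k) ρ ρ) (a * q)) (gate (lconv (r + k) (r + k) ρ ρ) (a * q)),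
          gate (lconv ((r + k) + (r + k)) (r + k) (lconv (r + k) (r + k) ρ ρ) ρ) (4 * (a * q) / 3)]
        ?_ ?_ (fun h => ?_) ?_
      · intro i; fin_cases i
        · exact hα0
        · exact hβ0
        · exact hwQ
        · exact hw3
      · rw [Fin.sum_univ_four]
        show q ^ 3 - (a * q) ^ 3 * ((1 - q) ^ 3 / (1 - a * q) ^ 3) - (a * q) * (3 * q * (1 - q) ^ 2 * (1 - a) / (1 - a * q) ^ 2)
          + (1 - q) ^ 3 / (1 - a * q) ^ 3 + 3 * q * (1 - q) ^ 2 * (1 - a) / (1 - a * q) ^ 2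
          + 3 * q * (1 - q) * (1 - a) * (q + a * q - 2 * (a * q) * q) / (1 - a * q) ^ 2 = 1
        field_simp
        ring
      · rw [Fin.sum_univ_four]
        exact gate_gluedFour_eq_mix_mid (r + k) ρ aM a q hmne h
      · intro i hi
        fin_cases i
        · exact hC
        · exact hB
        · exact hQ
        · exact hG3

  · -- {gate_m ρ⁴, t_m⁴, gate_m ρ² ∗ gate_m ρ², ρ³ ∗ gate_{4m−3} ρ}: the polarized corner `m > 3/4`, with the four-blob lift
    have h34' : 3 / 4 < a * q := lt_of_not_ge h34
    have hQ := decAtT_comp4_pairpair r k hg0 hg1 hm0 hm1.le j hj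
    have hX := decAtT_comp4_lift r k hg0 hg1 h34' hm1.le j
    have hwQ : 0 ≤ 3 * q * (1 - q) ^ 2 * (1 - a) / (1 - a * q) ^ 2 :=
      div_nonneg (mul_nonneg (mul_nonneg (by positivity) (sq_nonneg _)) (by linarith)) (sq_nonneg _)
    have hwX : 0 ≤ (a * q) * q * (1 - q) * (1 - a) * (q + a * q - 2 * (a * q) * q) / (1 - a * q) ^ 3 :=
      div_nonneg (mul_nonneg (mul_nonneg (mul_nonneg (mul_nonneg hm0.le hq0.le) (by linarith)) (by linarith)) hqm)
        (pow_nonneg (by linarith) 3)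
    have hα0 : 0 ≤ 1 - (1 - q) ^ 3 / (1 - a * q) ^ 3 - 3 * q * (1 - q) ^ 2 * (1 - a) / (1 - a * q) ^ 2
        - (a * q) * q * (1 - q) * (1 - a) * (q + a * q - 2 * (a * q) * q) / (1 - a * q) ^ 3 := by
      have hpos : 0 < (1 - a * q) ^ 3 := pow_pos (by linarith) 3
      have key : (1 - q) ^ 3 + 3 * q * (1 - q) ^ 2 * (1 - a) * (1 - a * q)
          + (a * q) * q * (1 - q) * (1 - a) * (q + a * q - 2 * (a * q) * q) ≤ (1 - a * q) ^ 3 := by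
        have e : (1 - a * q) ^ 3 - ((1 - q) ^ 3 + 3 * q * (1 - q) ^ 2 * (1 - a) * (1 - a * q)
            + (a * q) * q * (1 - q) * (1 - a) * (q + a * q - 2 * (a * q) * q)) = q * q * (1 - a) * (3 - 2 * q) * (1 - a * q) ^ 2 := by
          ring
        have h0 : 0 ≤ q * q * (1 - a) * (3 - 2 * q) * (1 - a * q) ^ 2 :=
          mul_nonneg (mul_nonneg (mul_nonneg (mul_nonneg hq0.le hq0.le) (by linarith)) (by linarith)) (sq_nonneg _)
        linarith
      have e : 1 - (1 - q) ^ 3 / (1 - a * q) ^ 3 - 3 * q * (1 - q) ^ 2 * (1 - a) / (1 - a * q) ^ 2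
          - (a * q) * q * (1 - q) * (1 - a) * (q + a * q - 2 * (a * q) * q) / (1 - a * q) ^ 3
          = ((1 - a * q) ^ 3 - ((1 - q) ^ 3 + 3 * q * (1 - q) ^ 2 * (1 - a) * (1 - a * q)
              + (a * q) * q * (1 - q) * (1 - a) * (q + a * q - 2 * (a * q) * q))) / (1 - a * q) ^ 3 := by
        field_simp
        ring
      rw [e]
      exact div_nonneg (by linarith) hpos.le
    refine decAtT_finite_mixture (ι := Fin 4) _ _ j _ _
      ![1 - (1 - q) ^ 3 / (1 - a * q) ^ 3 - 3 * q * (1 - q) ^ 2 * (1 - a) / (1 - a * q) ^ 2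
          - (a * q) * q * (1 - q) * (1 - a) * (q + a * q - 2 * (a * q) * q) / (1 - a * q) ^ 3,
        (1 - q) ^ 3 / (1 - a * q) ^ 3, 3 * q * (1 - q) ^ 2 * (1 - a) / (1 - a * q) ^ 2,
        (a * q) * q * (1 - q) * (1 - a) * (q + a * q - 2 * (a * q) * q) / (1 - a * q) ^ 3]
      ![gate (lconv ((r + k) + (r + k) + (r + k)) (r + k) (lconv ((r + k) + (r + k)) (r + k) (lconv (r + k) (r + k) ρ ρ) ρ) ρ) (a * q),
        lconv ((r + k) + (r + k) + (r + k)) (r + k)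
          (lconv ((r + k) + (r + k)) (r + k) (lconv (r + k) (r + k) (gate ρ (a * q)) (gate ρ (a * q))) (gate ρ (a * q))) (gate ρ (a * q)),
        lconv ((r + k) + (r + k)) ((r + k) + (r + k)) (gate (lconv (r + k) (r + k) ρ ρ) (a * q)) (gate (lconv (r + k) (r + k) ρ ρ) (a * q)),
        lconv ((r + k) + (r + k) + (r + k)) (r + k) (lconv ((r + k) + (r + k)) (r + k) (lconv (r + k) (r + k) ρ ρ) ρ)
          (gate ρ (4 * (a * q) - 3))]
      ?_ ?_ (fun h => ?_) ?_
    · intro i; fin_cases i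
      · exact hα0
      · exact hβ0
      · exact hwQ
      · exact hwX
    · rw [Fin.sum_univ_four]
      show 1 - (1 - q) ^ 3 / (1 - a * q) ^ 3 - 3 * q * (1 - q) ^ 2 * (1 - a) / (1 - a * q) ^ 2
          - (a * q) * q * (1 - q) * (1 - a) * (q + a * q - 2 * (a * q) * q) / (1 - a * q) ^ 3
        + (1 - q) ^ 3 / (1 - a * q) ^ 3 + 3 * q * (1 - q) ^ 2 * (1 - a) / (1 - a * q) ^ 2
        + (a * q) * q * (1 - q) * (1 - a) * (q + a * q - 2 * (a * q) * q) / (1 - a * q) ^ 3 = 1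
      ring
    · rw [Fin.sum_univ_four]
      exact gate_gluedFour_eq_mix_high (r + k) ρ aM a q hmne h
    · intro i hi
      fin_cases i
      · exact hC
      · exact hB
      · exact hQ
      · exact hX

end LawDec
end Quant
end Summit.CriticalPhenomena.PercolationContinuityZ3.Theorems
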